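import Mathlib
import HarnessLib
import Summits.Ventures.LatticeQCDFlow.Exactness.SUNSpectralPlaquetteLayerEquiv
import Summits.Ventures.LatticeQCDFlow.Exactness.KernelCouplingTranslation

/-!
# The `SU(N)` spectral PLAQUETTE coupling layer under mask-preserving lattice translations: the layer commutes with them and every exact Jacobian is translation invariant (a.e.; everywhere if continuous)

HONEST FRAMING: exact (Metropolis-corrected) sampling algorithms for lattice gauge theory;
figures of merit are autocorrelation/cost numbers at stated couplings and volumes; no
continuum-physics claim.

Venture `LatticeQCDFlow` (cell pub-lqcd), topic `Exactness`; FANOUT row 10 (`eng-equiv`, engine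
`latflow.equiv` `spectral.SUNSpectralCoupling` under the direction masks; acceptance suite
"translation covariance 0.0e+00" of the `SU(N)` presets; Boyda et al., PRD 103 (2021) 074504 §III.C,
named only).  NEW WORK of the cell, the translation twin of `SUNSpectralPlaquetteLayerClassFunction`:
the layer as a measurable automorphism for invertible eigenvalue flows
(`SUNSpectralPlaquetteLayerEquiv.exists_measurableEquiv_spectralPlaquetteLayer_sun`) combined with
`KernelCouplingTranslation` (kernel coupling layers intertwine translations; exact Jacobians of
translation-equivariant automorphisms are translation invariant).  Nothing is cited as a fact; no
number; no definition; no Jacobian is constructed and nothing of `SpectralDensityMeasurable` is used.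
HYPOTHESES on the translation `t`: it preserves the mask (`p e ↔ p (e + t)` — by
`directionMask_siteTranslate_of_ker` every `t` of the width sublattice does), the plane choice is
`t`-periodic, and the kernel field is translation covariant on active links
(`hol (V·t) e = hol V (e + t)` — a convolutional conditioner).

* **`spectralPlaquetteLayer_siteTranslate`** — the layer `V e ↦ hol V e (P) P⁻¹ V e` commutes with
  `Θ_t`: `F (V·t) = (F V)·t` (no spectral hypothesis is needed for this);
* **`ae_translationInvariant_jacobian_spectralPlaquetteLayer_sun`** — with invertible eigenvalue
  flows (two-sided inverses `g e y` realised by kernels `h' e y`, joint continuity — the hypotheses of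
  `exists_measurableEquiv_spectralPlaquetteLayer_sun`, verbatim), EVERY measurable exact Jacobian `J`
  of the layer for `⊗_e Haar_{SU(n)}` satisfies `J (V·t) = J V` for a.e. `V` — the form that applies
  to the booked spectral Jacobians, which jump at the alcove walls;
* **`translationInvariant_jacobian_spectralPlaquetteLayer_sun`** — every CONTINUOUS exact Jacobian
  `j ≥ 0` satisfies it everywhere.

NOT here: translations moving the mask to another phase of the cycle (`KernelCouplingTranslation`
has the single-layer intertwining for those); that a trained conditioner is translation covariant;
any number.
-/

noncomputable section

namespace Summit.Ventures.LatticeQCDFlow.Exactness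

open Matrix MeasureTheory
open Literature.LinearAlgebra.Matrix
open Literature.MathematicalPhysics.QuantumFieldTheory
open scoped ENNReal

variable {n : Type*} [Fintype n] [DecidableEq n] {d L : ℕ} [NeZero L]
  (p : Edge d L → Prop) [DecidablePred p] (ν : Edge d L → Fin d)
  (h1 : ∀ e, p e → ¬p (e.1.shift e.2, ν e)) (h2 : ∀ e, p e → ¬p (e.1.shift (ν e), e.2))
  (h3 : ∀ e, p e → ¬p (e.1, ν e))
  (hol : GaugeConfig d L (Matrix.specialUnitaryGroup n ℂ) → Edge d L →
    Matrix.specialUnitaryGroup n ℂ → Matrix.specialUnitaryGroup n ℂ)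
  (h h' : Edge d L → ({f : Edge d L // ¬p f} → Matrix.specialUnitaryGroup n ℂ) →
    Matrix.specialUnitaryGroup n ℂ → Matrix.specialUnitaryGroup n ℂ)
  (hHV : ∀ V e, p e → hol V e = h e (fun f => V f))
  (f g : Edge d L → ({f : Edge d L // ¬p f} → Matrix.specialUnitaryGroup n ℂ) → (n → ℂ) → (n → ℂ))
  (hf : ∀ e, ContinuousOn
    (fun q : ({f : Edge d L // ¬p f} → Matrix.specialUnitaryGroup n ℂ) × (n → ℂ) => f e q.1 q.2)
    {q | ∀ i, ‖q.2 i‖ = 1})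
  (hagree : ∀ e y (P : Matrix.specialUnitaryGroup n ℂ) (V : Matrix n n ℂ) (dg : n → ℂ),
    V ∈ Matrix.unitaryGroup n ℂ → (P : Matrix n n ℂ) = V * diagonal dg * star V →
      ((h e y P : Matrix.specialUnitaryGroup n ℂ) : Matrix n n ℂ) = V * diagonal (f e y dg) * star V)
  (hagree' : ∀ e y (P : Matrix.specialUnitaryGroup n ℂ) (V : Matrix n n ℂ) (dg : n → ℂ),
    V ∈ Matrix.unitaryGroup n ℂ → (P : Matrix n n ℂ) = V * diagonal dg * star V →
      ((h' e y P : Matrix.specialUnitaryGroup n ℂ) : Matrix n n ℂ) = V * diagonal (g e y dg) * star V)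
  (hgf : ∀ e y (dg : n → ℂ), (∀ i, ‖dg i‖ = 1) → ∏ i, dg i = 1 → g e y (f e y dg) = dg)
  (hfg : ∀ e y (dg : n → ℂ), (∀ i, ‖dg i‖ = 1) → ∏ i, dg i = 1 → f e y (g e y dg) = dg)
  (t : Site d L) (hν : ∀ e : Edge d L, ν (e.1 + t, e.2) = ν e)
  (hpt : ∀ e : Edge d L, p e ↔ p (e.1 + t, e.2))
  (hholt : ∀ (V : GaugeConfig d L (Matrix.specialUnitaryGroup n ℂ)) (e : Edge d L), p e →
    hol (GaugeConfig.siteTranslate t V) e = hol V (e.1 + t, e.2))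

include hν hpt hholt

omit [NeZero L] in
/-- **The spectral plaquette coupling layer commutes with every mask-preserving translation** under
which its plane choice is periodic and its kernel field covariant: `F (V·t) = (F V)·t`. -/
theorem spectralPlaquetteLayer_siteTranslate (V : GaugeConfig d L (Matrix.specialUnitaryGroup n ℂ)) :
    (fun e : Edge d L =>
        if p e then
          hol (GaugeConfig.siteTranslate t V) e
              (plaquetteHolonomy (GaugeConfig.siteTranslate t V) e.1 e.2 (ν e)) *
            (plaquetteHolonomy (GaugeConfig.siteTranslate t V) e.1 e.2 (ν e))⁻¹ *
              GaugeConfig.siteTranslate t V e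
        else GaugeConfig.siteTranslate t V e) =
      GaugeConfig.siteTranslate t (fun e : Edge d L =>
        if p e then hol V e (plaquetteHolonomy V e.1 e.2 (ν e)) * (plaquetteHolonomy V e.1 e.2 (ν e))⁻¹ * V e
        else V e) :=
  plaquetteKernelLayer_siteTranslate p p t ν hν hol hpt hholt V

include h1 h2 h3 hHV hf hagree hagree' hgf hfg

/-- **Every measurable exact Jacobian of the `SU(N)` spectral plaquette coupling layer is invariant
under mask-preserving translations, almost everywhere** (invertible eigenvalue flows; product Haar). -/
theorem ae_translationInvariant_jacobian_spectralPlaquetteLayer_sun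
    {J : GaugeConfig d L (Matrix.specialUnitaryGroup n ℂ) → ℝ≥0∞}
    (hJ : HasJacobian (Measure.pi fun _ : Edge d L => haarProbability (Matrix.specialUnitaryGroup n ℂ))
      (fun (V : GaugeConfig d L (Matrix.specialUnitaryGroup n ℂ)) (e : Edge d L) =>
        if p e then hol V e (plaquetteHolonomy V e.1 e.2 (ν e)) * (plaquetteHolonomy V e.1 e.2 (ν e))⁻¹ * V e
        else V e) J) :
    ∀ᵐ U ∂(Measure.pi fun _ : Edge d L => haarProbability (Matrix.specialUnitaryGroup n ℂ)),
      J (GaugeConfig.siteTranslate t U) = J U := by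
  obtain ⟨Ψ, hΨ⟩ := exists_measurableEquiv_spectralPlaquetteLayer_sun p ν h1 h2 h3 hol h h' hHV f g hf hagree
    hagree' hgf hfg
  have hcomm : ∀ V : GaugeConfig d L (Matrix.specialUnitaryGroup n ℂ),
      Ψ (GaugeConfig.siteTranslate t V) = GaugeConfig.siteTranslate t (Ψ V) := fun V => by
    rw [hΨ]
    exact spectralPlaquetteLayer_siteTranslate p ν hol t hν hpt hholt V
  rw [← hΨ] at hJ
  exact HasJacobian.jac_siteTranslate_ae_eq (haarProbability (Matrix.specialUnitaryGroup n ℂ)) t hcomm hJ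

/-- **… and everywhere for a continuous exact Jacobian `j ≥ 0`.** -/
theorem translationInvariant_jacobian_spectralPlaquetteLayer_sun
    {j : GaugeConfig d L (Matrix.specialUnitaryGroup n ℂ) → ℝ} (hj : Continuous j) (hj0 : ∀ U, 0 ≤ j U)
    (hJ : HasJacobian (Measure.pi fun _ : Edge d L => haarProbability (Matrix.specialUnitaryGroup n ℂ))
      (fun (V : GaugeConfig d L (Matrix.specialUnitaryGroup n ℂ)) (e : Edge d L) =>
        if p e then hol V e (plaquetteHolonomy V e.1 e.2 (ν e)) * (plaquetteHolonomy V e.1 e.2 (ν e))⁻¹ * V e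
        else V e) (fun U => ENNReal.ofReal (j U)))
    (U : GaugeConfig d L (Matrix.specialUnitaryGroup n ℂ)) : j (GaugeConfig.siteTranslate t U) = j U := by
  haveI : SecondCountableTopology (Matrix n n ℂ) := inferInstanceAs (SecondCountableTopology (n → n → ℂ))
  haveI : SecondCountableTopology (Matrix.specialUnitaryGroup n ℂ) :=
    Topology.IsEmbedding.subtypeVal.secondCountableTopology
  obtain ⟨Ψ, hΨ⟩ := exists_measurableEquiv_spectralPlaquetteLayer_sun p ν h1 h2 h3 hol h h' hHV f g hf hagree
    hagree' hgf hfg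
  have hcomm : ∀ V : GaugeConfig d L (Matrix.specialUnitaryGroup n ℂ),
      Ψ (GaugeConfig.siteTranslate t V) = GaugeConfig.siteTranslate t (Ψ V) := fun V => by
    rw [hΨ]
    exact spectralPlaquetteLayer_siteTranslate p ν hol t hν hpt hholt V
  rw [← hΨ] at hJ
  exact HasJacobian.jac_siteTranslate_eq t hcomm hj hj0 hJ U

end Summit.Ventures.LatticeQCDFlow.Exactness

end
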